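import Summits.ValiantsHypothesis.ValiantsHypothesis.Theorems.LacunarySymmetroidMatrixDescartesCensusDoorA34ChartAtlas

/-!
# `MatrixDescartes` census — DOOR A at `(3,4)`: really-split nets carry a real line pair too — `DoorA34` ⟺ the HOLLOW-CORNER rows ALONE

HONEST FRAMING.  Object-search cell `pub-symmetroid`, door-A seat `val-sym-door-p3` (g17); item stmt-ValiantsHypothesis-19980
`DoorA34 = PosRootLawAt 3 4 18` is OPEN and asserted nowhere in this file; the main theorem is an EQUIVALENCE between the door and ONE explicit
sixteen-parameter family of fewnomial rows, which is not bounded here.  Nothing bears on `MatrixDescartes` (stmt-ValiantsHypothesis-18050)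
or on `VP ≠ VNP`.

CONTENT (all supports; no `def`, no `sorry`).  `…ChartAtlas` proved `DoorA34 ↔ (E) ∧ (H)` (signed-equal-diagonal rows ∧ hollow-corner rows).
Here (E) is shown redundant:
* §16 `exists_neg_residual_product` (`∏ⱼ∏_{i≠j} aᵢ(μᵢ−μⱼ) = −(a₀a₁a₂)²∏_{i<j}(μᵢ−μⱼ)² < 0`, so some residual pair has opposite signs) and
  **`exists_congr_hollowCorner_of_split`**: a net with a REALLY-SPLIT annihilator pencil (`det B₁ ≠ 0`, three distinct real generalised
  eigenvalues — classes R4/R0) is ALSO congruent to a hollow-corner net: for the index `j` with residual entries `dᵢ = aᵢ(μᵢ − μⱼ)` of opposite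
  signs, `K = B₂ − μⱼB₁` is a real line pair on the plane of the other two eigenvectors, with isotropic frame `vⱼ, v_{i₁} ± t·v_{i₂}`,
  `t² = −d₁/d₂`, fed to `exists_congr_hollowCorner_of_frame` (R4 nets have three such `j`, R0 nets one);
* §17 `card_posRoots_le_of_hollowCorner_rows_split`, `card_posRoots_le_of_hollowCornerRows` (both branches of `annihilator_dichotomy`),
  **`doorA34_iff_hollowCornerRows`**: `DoorA34 ↔ ∀ d ε₁ ε₂ u w α β, εᵢ ∈ {1,0,−1} → Z₊(∑ X^{d_l}[[ε₁u_l+ε₂w_l,α_l,β_l],[α_l,u_l,0],[β_l,0,w_l]]) ≤ 18`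
  (det = `uw(ε₁u+ε₂w) − α²w − β²u`), and **`not_doorA34_iff_hollowCornerNineteen`**.
[folklore] Pencils of conics; elementary.
-/

-- `Summit.ValiantsHypothesis.ValiantsHypothesis.…` repeats a component by the D-0017 layout
-- (single-conjunct summit), which the `dupNamespace` linter flags; the name is mandated.
set_option linter.dupNamespace false

namespace Summit.ValiantsHypothesis.ValiantsHypothesis.Theorems.LacunarySymmetroidMatrixDescartes.Census.EqualDiagonal

open Matrix Finset
open scoped BigOperators

/-! ## 16. Really-split nets carry a real line-pair frame -/

/-- Entries of `V B Vᵀ` are the pairings of the ROWS of `V`. [folklore] -/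
theorem mul_mul_transpose_apply (V B : Matrix (Fin 3) (Fin 3) ℝ) (i k : Fin 3) :
    (V * B * Vᵀ) i k = V i ⬝ᵥ (B *ᵥ V k) := by
  simp only [Matrix.mul_assoc]
  simp only [Matrix.mul_apply, Matrix.transpose_apply, dotProduct, Matrix.mulVec]

/-- The three residual products of a really-split pencil multiply to a negative number:
`∏ⱼ ∏_{i≠j} aᵢ(μᵢ − μⱼ) = −(a₀a₁a₂)²·∏_{i<j}(μᵢ − μⱼ)² < 0`; hence one of them is negative. [folklore] -/
theorem exists_neg_residual_product (a μ : Fin 3 → ℝ) (ha : ∀ i, a i ≠ 0) (hμ : Function.Injective μ) :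
    ∃ j i₁ i₂ : Fin 3, j ≠ i₁ ∧ j ≠ i₂ ∧ i₁ ≠ i₂ ∧ a i₁ * (μ i₁ - μ j) * (a i₂ * (μ i₂ - μ j)) < 0 := by
  have h01 : μ 0 - μ 1 ≠ 0 := sub_ne_zero.mpr fun h => by have := hμ h; exact absurd this (by decide)
  have h02 : μ 0 - μ 2 ≠ 0 := sub_ne_zero.mpr fun h => by have := hμ h; exact absurd this (by decide)
  have h12 : μ 1 - μ 2 ≠ 0 := sub_ne_zero.mpr fun h => by have := hμ h; exact absurd this (by decide)
  set P₀ := a 1 * (μ 1 - μ 0) * (a 2 * (μ 2 - μ 0)) with hP₀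
  set P₁ := a 0 * (μ 0 - μ 1) * (a 2 * (μ 2 - μ 1)) with hP₁
  set P₂ := a 0 * (μ 0 - μ 2) * (a 1 * (μ 1 - μ 2)) with hP₂
  have hprod : P₀ * P₁ * P₂ = -((a 0 * a 1 * a 2) ^ 2 * ((μ 0 - μ 1) * (μ 0 - μ 2) * (μ 1 - μ 2)) ^ 2) := by
    rw [hP₀, hP₁, hP₂]; ring
  have hneg : P₀ * P₁ * P₂ < 0 := by
    rw [hprod, neg_lt_zero]
    have h1 : (a 0 * a 1 * a 2) ^ 2 > 0 := by
      have : a 0 * a 1 * a 2 ≠ 0 := mul_ne_zero (mul_ne_zero (ha 0) (ha 1)) (ha 2)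
      positivity
    have h2 : ((μ 0 - μ 1) * (μ 0 - μ 2) * (μ 1 - μ 2)) ^ 2 > 0 := by
      have : (μ 0 - μ 1) * (μ 0 - μ 2) * (μ 1 - μ 2) ≠ 0 := mul_ne_zero (mul_ne_zero h01 h02) h12
      positivity
    exact mul_pos h1 h2
  by_cases h0 : P₀ < 0
  · exact ⟨0, 1, 2, by decide, by decide, by decide, h0⟩
  by_cases h1 : P₁ < 0
  · exact ⟨1, 0, 2, by decide, by decide, by decide, h1⟩
  have h2 : P₂ < 0 := by
    push Not at h0 h1
    by_contra h2
    push Not at h2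
    have : 0 ≤ P₀ * P₁ * P₂ := mul_nonneg (mul_nonneg h0 h1) h2
    linarith
  exact ⟨2, 0, 1, by decide, by decide, by decide, h2⟩

/-- **REALLY-SPLIT NETS CARRY A REAL LINE-PAIR FRAME, hence the hollow-corner chart.**  Under the hypotheses of
`exists_congr_signedEqualDiag` (symmetric annihilators `B₁, B₂`, `det B₁ ≠ 0`, three distinct real generalised eigenvalues `μᵢ`) ONE
congruence brings every letter to hollow-corner form as well: for the index `j` whose residual entries `dᵢ = aᵢ(μᵢ − μⱼ)` (`i ≠ j`) have
opposite signs, the degenerate member `K = B₂ − μⱼB₁` is a real line pair on the plane of the other two eigenvectors, with isotropic frame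
`vⱼ, v_{i₁} ± t·v_{i₂}`, `t² = −d₁/d₂` (`exists_congr_hollowCorner_of_frame`).  So the signed-equal-diagonal family (classes R4/R0) is
already inside the hollow-corner family up to congruence. [folklore] -/
theorem exists_congr_hollowCorner_of_split (S : Fin 4 → Matrix (Fin 3) (Fin 3) ℝ) (hS : ∀ l, (S l).IsSymm)
    (B₁ B₂ : Matrix (Fin 3) (Fin 3) ℝ) (hB₁ : B₁.IsSymm) (hB₂ : B₂.IsSymm) (hdet : B₁.det ≠ 0)
    (hann₁ : ∀ l, (B₁ * S l).trace = 0) (hann₂ : ∀ l, (B₂ * S l).trace = 0)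
    (μ : Fin 3 → ℝ) (hμ : Function.Injective μ) (hroot : ∀ i, (B₂ - μ i • B₁).det = 0) :
    ∃ (P : Matrix (Fin 3) (Fin 3) ℝ) (ε₁ ε₂ : ℝ) (u w α β : Fin 4 → ℝ), P.det ≠ 0 ∧
      (ε₁ = 1 ∨ ε₁ = 0 ∨ ε₁ = -1) ∧ (ε₂ = 1 ∨ ε₂ = 0 ∨ ε₂ = -1) ∧
      ∀ l, S l = Pᵀ * !![ε₁ * u l + ε₂ * w l, α l, β l; α l, u l, 0; β l, 0, w l] * P := by
  obtain ⟨V, hVdet, a, ha, hVB₁, hVB₂⟩ := exists_congr_diagonal_pair B₁ B₂ hB₁ hB₂ hdet μ hμ hroot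
  -- pairings of the rows of `V`
  have hfB₁ : ∀ i k, V i ⬝ᵥ (B₁ *ᵥ V k) = if i = k then a i else 0 := by
    intro i k
    rw [← mul_mul_transpose_apply, hVB₁, diagonal_apply]
  have hfB₂ : ∀ i k, V i ⬝ᵥ (B₂ *ᵥ V k) = if i = k then μ i * a i else 0 := by
    intro i k
    rw [← mul_mul_transpose_apply, hVB₂, diagonal_apply]
  have hfK : ∀ j i k, V i ⬝ᵥ ((B₂ - μ j • B₁) *ᵥ V k) = if i = k then a i * (μ i - μ j) else 0 := by
    intro j i k
    rw [Matrix.sub_mulVec, Matrix.smul_mulVec, dotProduct_sub, dotProduct_smul, smul_eq_mul, hfB₁, hfB₂]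
    by_cases hik : i = k
    · rw [if_pos hik, if_pos hik, if_pos hik]; ring
    · rw [if_neg hik, if_neg hik, if_neg hik]; ring
  -- `K_j v_j = 0`
  have hKv : ∀ j, (B₂ - μ j • B₁) *ᵥ V j = 0 := by
    intro j
    have hV : V *ᵥ ((B₂ - μ j • B₁) *ᵥ V j) = 0 := by
      funext i
      have h := hfK j i j
      simp only [Matrix.mulVec, Pi.zero_apply] at h ⊢
      rw [show (fun k => V i k) ⬝ᵥ ((B₂ - μ j • B₁) *ᵥ V j) = V i ⬝ᵥ ((B₂ - μ j • B₁) *ᵥ V j) from rfl, hfK]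
      by_cases hij : i = j
      · rw [if_pos hij, hij, sub_self, mul_zero]
      · rw [if_neg hij]
    have hVunit : IsUnit V.det := isUnit_iff_ne_zero.mpr hVdet
    calc (B₂ - μ j • B₁) *ᵥ V j = (V⁻¹ * V) *ᵥ ((B₂ - μ j • B₁) *ᵥ V j) := by
          rw [Matrix.nonsing_inv_mul V hVunit, Matrix.one_mulVec]
      _ = 0 := by rw [← Matrix.mulVec_mulVec, hV, Matrix.mulVec_zero]
  -- the frame for a good index triple
  obtain ⟨j, i₁, i₂, hj₁, hj₂, h₁₂, hneg⟩ := exists_neg_residual_product a μ ha hμ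
  set K := B₂ - μ j • B₁ with hKdef
  have hK : K.IsSymm := by
    show Kᵀ = K
    rw [hKdef, transpose_sub, transpose_smul, hB₁.eq, hB₂.eq]
  have hannK : ∀ l, (K * S l).trace = 0 := by
    intro l
    rw [hKdef, Matrix.sub_mul, Matrix.smul_mul, trace_sub, trace_smul, hann₁, hann₂, smul_zero, sub_zero]
  set d₁ := a i₁ * (μ i₁ - μ j) with hd₁
  set d₂ := a i₂ * (μ i₂ - μ j) with hd₂
  have hd₂ne : d₂ ≠ 0 := by
    intro h0; rw [h0, mul_zero] at hneg; exact lt_irrefl 0 hneg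
  have hd₁ne : d₁ ≠ 0 := by
    intro h0; rw [h0, zero_mul] at hneg; exact lt_irrefl 0 hneg
  have hratio : 0 < -d₁ / d₂ := by
    have : d₁ / d₂ < 0 := by
      rcases lt_or_gt_of_ne hd₂ne with h | h
      · exact div_neg_of_pos_of_neg (by nlinarith) h
      · exact div_neg_of_neg_of_pos (by nlinarith) h
    rw [neg_div]; linarith
  set t := Real.sqrt (-d₁ / d₂) with ht
  have htt : t * t = -d₁ / d₂ := Real.mul_self_sqrt hratio.le
  have htpos : 0 < t := Real.sqrt_pos.mpr hratio
  have htd : t * t * d₂ = -d₁ := by rw [htt]; field_simp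
  set v : Fin 3 → ℝ := V j with hvdef
  set w₁ : Fin 3 → ℝ := (1 : ℝ) • V i₁ + t • V i₂ with hw₁def
  set w₂ : Fin 3 → ℝ := (1 : ℝ) • V i₁ + (-t) • V i₂ with hw₂def
  have ha' : v ⬝ᵥ (B₁ *ᵥ v) ≠ 0 := by rw [hvdef, hfB₁, if_pos rfl]; exact ha j
  have hvw : ∀ s : ℝ, v ⬝ᵥ (B₁ *ᵥ ((1 : ℝ) • V i₁ + s • V i₂)) = 0 := by
    intro s
    rw [hvdef, Matrix.mulVec_add, Matrix.mulVec_smul, Matrix.mulVec_smul, dotProduct_add, dotProduct_smul, dotProduct_smul,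
      hfB₁, hfB₁, if_neg hj₁, if_neg hj₂, smul_zero, smul_zero, add_zero]
  have hquad : ∀ s s' : ℝ, ((1 : ℝ) • V i₁ + s • V i₂) ⬝ᵥ (K *ᵥ ((1 : ℝ) • V i₁ + s' • V i₂)) = d₁ + s * s' * d₂ := by
    intro s s'
    rw [dotProduct_mulVec_combo hK, hKdef, hfK, hfK, hfK, if_pos rfl, if_neg h₁₂, if_pos rfl, hd₁, hd₂]
    ring
  have hiso₁ : w₁ ⬝ᵥ (K *ᵥ w₁) = 0 := by rw [hw₁def, hquad]; linarith
  have hiso₂ : w₂ ⬝ᵥ (K *ᵥ w₂) = 0 := by rw [hw₂def, hquad]; nlinarith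
  have hκ : w₁ ⬝ᵥ (K *ᵥ w₂) ≠ 0 := by
    rw [hw₁def, hw₂def, hquad]
    have : d₁ + t * -t * d₂ = 2 * d₁ := by nlinarith
    rw [this]; exact mul_ne_zero two_ne_zero hd₁ne
  have hVw : (Matrix.of ![v, w₁, w₂]).det ≠ 0 := by
    rw [hvdef, hw₁def, hw₂def, det_of_combo_rows]
    refine mul_ne_zero (by nlinarith) ?_
    -- `det [V j, V i₁, V i₂]² = (det V)²`
    have hperm : (Matrix.of ![V j, V i₁, V i₂]).det ^ 2 = V.det ^ 2 := by
      rw [Matrix.det_fin_three, Matrix.det_fin_three]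
      fin_cases j <;> fin_cases i₁ <;> fin_cases i₂ <;> simp at hj₁ hj₂ h₁₂ <;> simp <;> ring
    intro h0
    rw [h0] at hperm
    have : V.det ^ 2 = 0 := by rw [← hperm]; ring
    exact hVdet ((pow_eq_zero_iff two_ne_zero).mp this)
  exact exists_congr_hollowCorner_of_frame S hS B₁ K hB₁ hK hann₁ hannK v w₁ w₂ hVw (hKv j) ha' (hvw t) (hvw (-t))
    hiso₁ hiso₂ hκ

/-! ## 17. `DoorA34` ⟺ the hollow-corner rows ALONE -/

/-- Census form on the really-split sector through the hollow-corner chart. [folklore] -/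
theorem card_posRoots_le_of_hollowCorner_rows_split (d : Fin 4 → ℕ) {N : ℕ}
    (hHC : ∀ (ε₁ ε₂ : ℝ) (u w α β : Fin 4 → ℝ), (ε₁ = 1 ∨ ε₁ = 0 ∨ ε₁ = -1) → (ε₂ = 1 ∨ ε₂ = 0 ∨ ε₂ = -1) →
      ((Matrix.det (∑ l, ((Polynomial.X : Polynomial ℝ) ^ d l) •
          (!![ε₁ * u l + ε₂ * w l, α l, β l; α l, u l, 0; β l, 0, w l] : Matrix (Fin 3) (Fin 3) ℝ).map Polynomial.C)).roots.toFinset.filter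
            (fun t => 0 < t)).card ≤ N)
    (S : Fin 4 → Matrix (Fin 3) (Fin 3) ℝ) (hS : ∀ l, (S l).IsSymm)
    (B₁ B₂ : Matrix (Fin 3) (Fin 3) ℝ) (hB₁ : B₁.IsSymm) (hB₂ : B₂.IsSymm) (hdet : B₁.det ≠ 0)
    (hann₁ : ∀ l, (B₁ * S l).trace = 0) (hann₂ : ∀ l, (B₂ * S l).trace = 0)
    (μ : Fin 3 → ℝ) (hμ : Function.Injective μ) (hroot : ∀ i, (B₂ - μ i • B₁).det = 0) :
    ((Matrix.det (∑ l, ((Polynomial.X : Polynomial ℝ) ^ d l) • (S l).map Polynomial.C)).roots.toFinset.filter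
        (fun t => 0 < t)).card ≤ N := by
  obtain ⟨P, ε₁, ε₂, u, w, α, β, hP, hε₁, hε₂, hSP⟩ :=
    exists_congr_hollowCorner_of_split S hS B₁ B₂ hB₁ hB₂ hdet hann₁ hann₂ μ hμ hroot
  have hfun : S = fun l => Pᵀ * !![ε₁ * u l + ε₂ * w l, α l, β l; α l, u l, 0; β l, 0, w l] * P := funext hSP
  rw [hfun, card_posRoots_congr d _ Pᵀ P (by rwa [det_transpose]) hP]
  exact hHC ε₁ ε₂ u w α β hε₁ hε₂

/-- **THE DOOR-A ROW OFF THE DISCRIMINANT REDUCES TO THE HOLLOW-CORNER ROWS ALONE** (both branches of `annihilator_dichotomy` now land in the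
hollow-corner chart). [folklore] -/
theorem card_posRoots_le_of_hollowCornerRows (d : Fin 4 → ℕ) {N : ℕ}
    (hHC : ∀ (ε₁ ε₂ : ℝ) (u w α β : Fin 4 → ℝ), (ε₁ = 1 ∨ ε₁ = 0 ∨ ε₁ = -1) → (ε₂ = 1 ∨ ε₂ = 0 ∨ ε₂ = -1) →
      ((Matrix.det (∑ l, ((Polynomial.X : Polynomial ℝ) ^ d l) •
          (!![ε₁ * u l + ε₂ * w l, α l, β l; α l, u l, 0; β l, 0, w l] : Matrix (Fin 3) (Fin 3) ℝ).map Polynomial.C)).roots.toFinset.filter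
            (fun t => 0 < t)).card ≤ N)
    (S : Fin 4 → Matrix (Fin 3) (Fin 3) ℝ) (hS : ∀ l, (S l).IsSymm)
    (B₁ B₂ : Matrix (Fin 3) (Fin 3) ℝ) (hB₁ : B₁.IsSymm) (hB₂ : B₂.IsSymm) (hdet : B₁.det ≠ 0)
    (hann₁ : ∀ l, (B₁ * S l).trace = 0) (hann₂ : ∀ l, (B₂ * S l).trace = 0)
    (hdisc : (B₁.adjugate * B₂).trace ^ 2 * (-(B₂.adjugate * B₁).trace) ^ 2
        - 4 * (-B₁.det) * (-(B₂.adjugate * B₁).trace) ^ 3 - 4 * (B₁.adjugate * B₂).trace ^ 3 * B₂.det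
        - 27 * (-B₁.det) ^ 2 * B₂.det ^ 2
        + 18 * (-B₁.det) * (B₁.adjugate * B₂).trace * (-(B₂.adjugate * B₁).trace) * B₂.det ≠ 0) :
    ((Matrix.det (∑ l, ((Polynomial.X : Polynomial ℝ) ^ d l) • (S l).map Polynomial.C)).roots.toFinset.filter
        (fun t => 0 < t)).card ≤ N := by
  rcases annihilator_dichotomy B₁ B₂ hdet hdisc with ⟨μ, hμ, hroots⟩ | ⟨μ, hroot, huniq, hsimple⟩
  · exact card_posRoots_le_of_hollowCorner_rows_split d hHC S hS B₁ B₂ hB₁ hB₂ hdet hann₁ hann₂ μ hμ hroots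
  · exact card_posRoots_le_of_hollowCorner_rows_uniqueRoot d hHC S hS B₁ B₂ hB₁ hB₂ hdet hann₁ hann₂ μ hroot huniq hsimple

/-- **`DoorA34` IS ONE SIXTEEN-PARAMETER FEWNOMIAL ROW FAMILY.**  The cell's typed target `DoorA34 = PosRootLawAt 3 4 18` (`Iff.rfl`-equal to
the route item `Theses.LacunarySymmetroid.DoorA34`, stmt-ValiantsHypothesis-19980) holds IF AND ONLY IF for every exponent vector
`d : Fin 4 → ℕ`, all signs `ε₁, ε₂ ∈ {1, 0, −1}` and all real `4 × 4` coefficient data `u, w, α, β : Fin 4 → ℝ` the HOLLOW-CORNER pencil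
`∑_l X^{d_l} [[ε₁u_l + ε₂w_l, α_l, β_l], [α_l, u_l, 0], [β_l, 0, w_l]]` — determinant `uw(ε₁u + ε₂w) − α²w − β²u` with `u, w, α, β` now the
`4`-nomials `∑_l u_l x^{d_l}`, … — has at most `18` distinct positive roots of its determinant.  (`doorA34_iff_chartRows` minus the redundant
signed-equal-diagonal family: really-split nets carry a real line pair too, `exists_congr_hollowCorner_of_split`.)  Nothing is bounded
here; `DoorA34` stays OPEN. [folklore] -/
theorem doorA34_iff_hollowCornerRows :
    DoorA34 ↔
      ∀ (d : Fin 4 → ℕ) (ε₁ ε₂ : ℝ) (u w α β : Fin 4 → ℝ), (ε₁ = 1 ∨ ε₁ = 0 ∨ ε₁ = -1) → (ε₂ = 1 ∨ ε₂ = 0 ∨ ε₂ = -1) →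
        ((Matrix.det (∑ l, ((Polynomial.X : Polynomial ℝ) ^ d l) •
            (!![ε₁ * u l + ε₂ * w l, α l, β l; α l, u l, 0; β l, 0, w l] : Matrix (Fin 3) (Fin 3) ℝ).map
              Polynomial.C)).roots.toFinset.filter (fun t => 0 < t)).card ≤ 18 := by
  constructor
  · intro h d ε₁ ε₂ u w α β _ _
    exact hollowCorner_rows_of_doorA34 h d ε₁ ε₂ u w α β
  · intro hHC
    obtain ⟨Φ, hΦ₀, hΦ⟩ := exists_generic_polynomial
    refine (DenseRows.doorA34_iff_rows_off_hypersurface Φ hΦ₀).mpr fun d S hS hne => ?_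
    obtain ⟨B₁, B₂, hB₁, hB₂, hann₁, hann₂, hdet, hdisc⟩ := hΦ S hS hne
    exact card_posRoots_le_of_hollowCornerRows d (hHC d) S hS B₁ B₂ hB₁ hB₂ hdet hann₁ hann₂ hdisc

/-- **Refutation currency**: `DoorA34` fails iff SOME hollow-corner pencil on SOME support has `≥ 19` distinct positive det-roots. [folklore] -/
theorem not_doorA34_iff_hollowCornerNineteen :
    ¬ DoorA34 ↔
      ∃ (d : Fin 4 → ℕ) (ε₁ ε₂ : ℝ) (u w α β : Fin 4 → ℝ), (ε₁ = 1 ∨ ε₁ = 0 ∨ ε₁ = -1) ∧ (ε₂ = 1 ∨ ε₂ = 0 ∨ ε₂ = -1) ∧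
        19 ≤ ((Matrix.det (∑ l, ((Polynomial.X : Polynomial ℝ) ^ d l) •
            (!![ε₁ * u l + ε₂ * w l, α l, β l; α l, u l, 0; β l, 0, w l] : Matrix (Fin 3) (Fin 3) ℝ).map
              Polynomial.C)).roots.toFinset.filter (fun t => 0 < t)).card := by
  rw [doorA34_iff_hollowCornerRows]
  push Not
  constructor
  · rintro ⟨d, ε₁, ε₂, u, w, α, β, h₁, h₂, hlt⟩
    exact ⟨d, ε₁, ε₂, u, w, α, β, h₁, h₂, by omega⟩
  · rintro ⟨d, ε₁, ε₂, u, w, α, β, h₁, h₂, hle⟩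
    exact ⟨d, ε₁, ε₂, u, w, α, β, h₁, h₂, by omega⟩

end Summit.ValiantsHypothesis.ValiantsHypothesis.Theorems.LacunarySymmetroidMatrixDescartes.Census.EqualDiagonal
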